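import Literature.NumberTheory.IwasawaTheory.ClassicalMuVanishesDivisionFieldFiveG9
import Literature.NumberTheory.EllipticCurves.FineSelmerClassGroupCriterion
import HarnessLib

set_option autoImplicit false

/-!
# Statement (A) of Coates–Sujatha at `p = 5` for curves with mod-5 image Zywina's `G₉` (`5S4`), from `μ = 0` of six subfields of
# `ℚ(E[5])` (road (b): `CoatesSujatha2005.thm34` ∘ `ClassicalMuVanishesDivisionFieldFiveG9`)

Topic `NumberTheory/EllipticCurves`; THEOREM-ONLY file (no definition, no named fact, no `sorry`); literature seat `bsd-potss-conjA-anchor`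
g12 (supports the KT fine-Selmer crux stmt-BirchSwinnertonDyer-19413 and its residue parent 19916, rows with image `5S4`; closes nothing).
The composite of the named fact `CoatesSujatha2005.thm34_fineSelmerDual_moduleFinite_of_classicalMuVanishes_divisionField` (road (b)) with
`classicalMuVanishes_divisionField_of_zywinaG9Basis_five`: statement (A) for `E` at `5` (`Sel₀(E/ℚ_cyc)^∨` finitely generated over `ℤ_5`,
in the tree's `∃ γ D, Module.Finite ℤ_[5] D.X` form) from a basis `e` of `E[5]` in which `Γ_ℚ` acts through `G₉`, three elements
`σ_u, σ_w, σ_t ∈ Γ_ℚ` acting as `diag(1,2)`, `(0 −1; 1 0)`, `(1 1; 1 −1)`, and «`μ = 0`» for the six fields `ℚ(P₁) = ℚ(E[5])^{⟨σ̄_u⟩}` (24),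
`ℚ(x(P₁), x(P₂)) = ℚ(E[5])^{⟨σ̄_w², σ̄_u²⟩}` (24), `ℚ(E[5])^{⟨σ̄_uσ̄_w²⟩}` (24), `ℚ(E[5])^{⟨σ̄_w⟩}` (24), `ℚ(x(P₁)) = ℚ(E[5])^{⟨σ̄_u, σ̄_w²⟩}` (12),
`ℚ(E[5])^{⟨σ̄_w, σ̄_u²⟩}` (12) — the ONLY named fact on the way is Coates–Sujatha Thm. 3.4 (no growth theorem, no Ferrero–Washington).

References: [CoatesSujatha2005, Thm. 3.4]; [KuriharaPollack2007, §3.1]; [Lemmermeyer1994, §1]; [Washington1997, §13.1]; [Zywina2015, §1.3].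
-/

noncomputable section

open scoped NumberField Matrix

open Field IntermediateField WeierstrassCurve Literature.NumberTheory.EllipticCurves Literature.NumberTheory.GaloisRepresentations
  Literature.NumberTheory.EllipticCurves.Zywina2015G9 Literature.NumberTheory.IwasawaTheory

namespace Literature.NumberTheory.EllipticCurves.CoatesSujatha2005

/-- **Statement (A) at `5` for mod-5 image `G₉` (`5S4`), from `μ = 0` of six subfields of `ℚ(E[5])`** (modulo Coates–Sujatha Thm. 3.4
alone, a named fact): with `e`, `σ_u, σ_w, σ_t` and the six `μ`-inputs as in `classicalMuVanishes_divisionField_of_zywinaG9Basis_five`, for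
every cyclotomic `ℤ_5`-extension `κ` of `ℚ` the dual fine Selmer group of `E` over `ℚ_cyc` is finitely generated over `ℤ_5`.
[cite: CoatesSujatha2005, Thm. 3.4 (§3)] [cite: KuriharaPollack2007, §3.1] [cite: Lemmermeyer1994, §1 (Kuroda's class number formula)]
[cite: Zywina2015, §1.3 (G₉ and its generators)] -/
theorem fineSelmerDual_moduleFinite_of_zywinaG9Basis_five
    (hCS : thm34_fineSelmerDual_moduleFinite_of_classicalMuVanishes_divisionField) [Fact (Nat.Prime 5)] (W : WeierstrassCurve ℚ)
    [W.IsElliptic] (e : W.geomTorsion (5 : ℕ) ≃+ (Fin 2 → ZMod 5))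
    (he : ∀ σ : absoluteGaloisGroup ℚ, ∃ M ∈ G9, ∀ P : W.geomTorsion (5 : ℕ),
      e (σ • P) = ((M : GL (Fin 2) (ZMod 5)) : Matrix (Fin 2) (Fin 2) (ZMod 5)) *ᵥ e P)
    (σu σw σt : absoluteGaloisGroup ℚ) (hσu : ∀ P : W.geomTorsion (5 : ℕ), e (σu • P) = !![1, 0; 0, 2] *ᵥ e P)
    (hσw : ∀ P : W.geomTorsion (5 : ℕ), e (σw • P) = !![0, 4; 1, 0] *ᵥ e P)
    (hσt : ∀ P : W.geomTorsion (5 : ℕ), e (σt • P) = !![1, 1; 1, 4] *ᵥ e P)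
    (hμP : ∀ κE : ZpExtension ↥(fixedField (Subgroup.zpowers (absRestrictNormalHom (W.divisionField 5) σu))) 5,
      κE.IsCyclotomic → ClassicalMuVanishes κE)
    (hμA₁ : ∀ κE : ZpExtension ↥(fixedField (Subgroup.zpowers (absRestrictNormalHom (W.divisionField 5) σw ^ 2) ⊔
        Subgroup.zpowers (absRestrictNormalHom (W.divisionField 5) σu ^ 2))) 5,
      κE.IsCyclotomic → ClassicalMuVanishes κE)
    (hμA₂ : ∀ κE : ZpExtension ↥(fixedField (Subgroup.zpowers (absRestrictNormalHom (W.divisionField 5) σu *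
        absRestrictNormalHom (W.divisionField 5) σw ^ 2))) 5,
      κE.IsCyclotomic → ClassicalMuVanishes κE)
    (hμA₃ : ∀ κE : ZpExtension ↥(fixedField (Subgroup.zpowers (absRestrictNormalHom (W.divisionField 5) σw))) 5,
      κE.IsCyclotomic → ClassicalMuVanishes κE)
    (hμB₁ : ∀ κE : ZpExtension ↥(fixedField (Subgroup.zpowers (absRestrictNormalHom (W.divisionField 5) σu) ⊔
        Subgroup.zpowers (absRestrictNormalHom (W.divisionField 5) σw ^ 2))) 5,
      κE.IsCyclotomic → ClassicalMuVanishes κE)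
    (hμD : ∀ κE : ZpExtension ↥(fixedField (Subgroup.zpowers (absRestrictNormalHom (W.divisionField 5) σw) ⊔
        Subgroup.zpowers (absRestrictNormalHom (W.divisionField 5) σu ^ 2))) 5,
      κE.IsCyclotomic → ClassicalMuVanishes κE)
    (κ : ZpExtension ℚ 5) (hκ : κ.IsCyclotomic) :
    ∃ (γ : absoluteGaloisGroup ℚ) (D : W.FineSelmerDualData κ γ), Module.Finite ℤ_[5] (RestrictScalars ℤ_[5] (IwasawaAlgebra 5) D.X) :=
  hCS W 5 (by decide)
    (classicalMuVanishes_divisionField_of_zywinaG9Basis_five W e he σu σw σt hσu hσw hσt hμP hμA₁ hμA₂ hμA₃ hμB₁ hμD) κ hκ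

end Literature.NumberTheory.EllipticCurves.CoatesSujatha2005

end
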